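import Summits.QuantumFields.YangMills.Theorems.FemtoTransferGapRungW1upLink
import Literature.MathematicalPhysics.QuantumLattice.SU2Haar
import HarnessLib

/-!
# The zero-flux transfer kernel of `SU(2)` on the torus `(ℤ/L)³`, ANY `L`: factorisation `K_β = E_β · e^{−(β/2)(S(U)+S(V))}`, the link-product
# (electric) kernel `E_β(U,V) = ∏ₑ w_β(UₑVₑ⁻¹)`, its row and column sums `c_β^{3L³}`
# (sub-stub C1a of the fixed-lattice programme COARSE(L₀) — route `LuscherReduction`, crux RED stmt-QuantumFields-19978 KT-door 3b′ /
# crux `TwistedTraceScaling` stmt-QuantumFields-20203 S-BASE; card `pub/ym-fleet/ym-luscher-20007-p1/Lines-base-coarse-cut.md`)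

The one-site (`L = 1`) versions of everything below are `FemtoTransferGapRungW1upSite` Part C (`linkE`, `linkCE`, `integral_linkE_snd`, …), typed
over `Cfg = GaugeConfig 3 1 SU2`.  Every fixed-lattice semiclassical statement of the COARSE programme (large-field suppression, valley bounds,
Born–Oppenheimer comparison with the one-site model) lives on `GaugeConfig 3 L SU2` for a general lattice size `L`; this module supplies the
`L`-generic kernel bookkeeping, with the same proofs:

* `latE L β U V = ∏_{e : Edge 3 L} w_β(Uₑ Vₑ⁻¹)` (`w_β = linkW β`, tree), `latE_eq_exp : latE = exp(β · timeCoupling)`, positivity, the bound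
  `latE ≤ e^{2β|E|}`, continuity / measurability;
* `transferKernel_eq_latE_mul : K_β(U,V) = latE(U,V) · exp(−(β/2)(S(U)+S(V)))`, `transferKernel_le_latE` (`S ≥ 0`), `|K_β| ≤ e^{2β|E|}`,
  measurability of `K_β` on `GaugeConfig 3 L SU2 × GaugeConfig 3 L SU2`;
* `latCE L β = c_β^{|E|}` (`c_β = linkC β`, tree; `|E| = 3L³` positively oriented links) and the ROW / COLUMN SUMS
  `∫ latE(U,V) dμ(V) = ∫ latE(U,V) dμ(U) = latCE L β` (per-link Haar invariance + Fubini over the product measure), with the weighted versions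
  `∫∫ latE · Φ(U) = latCE · ∫Φ`, `∫∫ latE · Φ(V) = latCE · ∫Φ`.

The Schur test and the large-field suppression built on these are `…RunningReductionLatticeLargeField.lean`.
HONEST FRAMING: measure-theoretic bookkeeping on `SU(2)^{3L³}`; no semiclassics; femto rung R2b1; not a gap, not Clay.
-/

set_option autoImplicit false

noncomputable section

open MeasureTheory Filter Topology Real
open scoped Matrix ComplexConjugate BigOperators
open Literature.MathematicalPhysics.QuantumFieldTheory
open Literature.MathematicalPhysics.QuantumLattice

namespace Summit.QuantumFields.YangMills.Theorems.FemtoTransferGap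

variable (L : ℕ) [NeZero L]

/-! ## §1 The link-product (electric) kernel on `(ℤ/L)³` -/

/-- **Electric factor on the `L³` torus** `E_β(U,V) = ∏ₑ w_β(Uₑ Vₑ⁻¹)` (product over the `3L³` positively oriented links).
[cite: SeilerLNP1982, §3] -/
def latE (β : ℝ) (U V : GaugeConfig 3 L SU2) : ℝ := ∏ e : Edge 3 L, linkW β (U e * (V e)⁻¹)

variable {L}

/-- `0 < E_β`. [folklore] -/
theorem latE_pos (β : ℝ) (U V : GaugeConfig 3 L SU2) : 0 < latE L β U V := Finset.prod_pos fun _ _ => linkW_pos β _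

/-- `E_β = exp(β · timeCoupling)`. [folklore] -/
theorem latE_eq_exp (β : ℝ) (U V : GaugeConfig 3 L SU2) : latE L β U V = Real.exp (β * timeCoupling su2Rep U V) := by
  unfold latE linkW timeCoupling
  rw [Finset.mul_sum, Real.exp_sum]
  simp

/-- `E_β ≤ e^{2β|E|}` (`β ≥ 0`). [folklore] -/
theorem latE_le {β : ℝ} (hβ : 0 ≤ β) (U V : GaugeConfig 3 L SU2) : latE L β U V ≤ Real.exp (2 * β) ^ Fintype.card (Edge 3 L) := by
  unfold latE
  calc ∏ e, linkW β (U e * (V e)⁻¹) ≤ ∏ _e : Edge 3 L, Real.exp (2 * β) :=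
        Finset.prod_le_prod (fun e _ => (linkW_pos β _).le) fun e _ => linkW_le hβ _
    _ = Real.exp (2 * β) ^ Fintype.card (Edge 3 L) := by rw [Finset.prod_const, Finset.card_univ]

/-- `|E_β| ≤ e^{2β|E|}` (`β ≥ 0`). [folklore] -/
theorem abs_latE_le {β : ℝ} (hβ : 0 ≤ β) (U V : GaugeConfig 3 L SU2) : |latE L β U V| ≤ Real.exp (2 * β) ^ Fintype.card (Edge 3 L) := by
  rw [abs_of_pos (latE_pos β U V)]; exact latE_le hβ U V

/-- `E_β` is jointly continuous. [folklore] -/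
theorem continuous_latE (β : ℝ) : Continuous fun p : GaugeConfig 3 L SU2 × GaugeConfig 3 L SU2 => latE L β p.1 p.2 := by
  unfold latE
  exact continuous_finsetProd _ fun e _ => (continuous_linkW β).comp
    (((continuous_apply e).comp continuous_fst).mul ((continuous_apply e).comp continuous_snd).inv)

/-- `E_β` is jointly measurable. [folklore] -/
theorem measurable_latE (β : ℝ) : Measurable fun p : GaugeConfig 3 L SU2 × GaugeConfig 3 L SU2 => latE L β p.1 p.2 := by
  haveI := secondCountableTopology_su2
  exact (continuous_latE β).measurable

/-- The `SU(2)` Wilson action of the torus is non-negative (`Re tr U_p ≤ 2`). [folklore] -/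
theorem wilsonAction_su2_nonneg_lat (U : GaugeConfig 3 L SU2) : 0 ≤ wilsonAction su2Rep U := by
  unfold wilsonAction
  refine Finset.sum_nonneg fun p _ => ?_
  have h := re_trace_le_two (plaquetteHolonomy U p.1 p.2.1.1 p.2.1.2)
  simp only [fundamentalRep_apply, Nat.cast_ofNat]
  linarith

/-! ## §2 Factorisation of the transfer kernel -/

/-- **`K_β = E_β · exp(−(β/2)(S(U)+S(V)))`** on the `L³` torus. [cite: SeilerLNP1982, §3] -/
theorem transferKernel_eq_latE_mul (β : ℝ) (U V : GaugeConfig 3 L SU2) : transferKernel su2Rep β U V =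
    latE L β U V * Real.exp (-(β / 2) * (wilsonAction su2Rep U + wilsonAction su2Rep V)) := by
  rw [transferKernel, latE_eq_exp, ← Real.exp_add]
  congr 1; ring

/-- **`K_β ≤ E_β`** (`β ≥ 0`; the magnetic Boltzmann factor is `≤ 1`). [folklore] -/
theorem transferKernel_le_latE {β : ℝ} (hβ : 0 ≤ β) (U V : GaugeConfig 3 L SU2) : transferKernel su2Rep β U V ≤ latE L β U V := by
  rw [transferKernel_eq_latE_mul]
  have hS := add_nonneg (wilsonAction_su2_nonneg_lat U) (wilsonAction_su2_nonneg_lat V)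
  have h1 : Real.exp (-(β / 2) * (wilsonAction su2Rep U + wilsonAction su2Rep V)) ≤ 1 :=
    Real.exp_le_one_iff.mpr (by nlinarith)
  calc latE L β U V * Real.exp (-(β / 2) * (wilsonAction su2Rep U + wilsonAction su2Rep V))
      ≤ latE L β U V * 1 := mul_le_mul_of_nonneg_left h1 (latE_pos β U V).le
    _ = latE L β U V := mul_one _

/-- **`K_β ≥ e^{−β s₀} E_β`** where both magnetic energies are `≤ s₀` (`β ≥ 0`). [folklore] -/
theorem exp_mul_latE_le_transferKernel {β : ℝ} (hβ : 0 ≤ β) {s₀ : ℝ} {U V : GaugeConfig 3 L SU2}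
    (hU : wilsonAction su2Rep U ≤ s₀) (hV : wilsonAction su2Rep V ≤ s₀) :
    Real.exp (-(β * s₀)) * latE L β U V ≤ transferKernel su2Rep β U V := by
  rw [transferKernel_eq_latE_mul, mul_comm]
  refine mul_le_mul_of_nonneg_left (Real.exp_le_exp.2 ?_) (latE_pos β U V).le
  nlinarith

/-- `|K_β| ≤ e^{2β|E|}` on the `L³` torus (`β ≥ 0`). [folklore] -/
theorem abs_transferKernel_le_lat {β : ℝ} (hβ : 0 ≤ β) (p : GaugeConfig 3 L SU2 × GaugeConfig 3 L SU2) :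
    |transferKernel su2Rep β p.1 p.2| ≤ Real.exp (2 * β) ^ Fintype.card (Edge 3 L) := by
  rw [abs_of_pos (transferKernel_pos _ _ _ _)]
  exact (transferKernel_le_latE hβ _ _).trans (latE_le hβ _ _)

/-- `K_β` is jointly measurable on the `L³` torus. [folklore] -/
theorem measurable_transferKernel_lat (β : ℝ) :
    Measurable fun p : GaugeConfig 3 L SU2 × GaugeConfig 3 L SU2 => transferKernel su2Rep β p.1 p.2 := by
  haveI := secondCountableTopology_su2
  exact (continuous_transferKernel su2Rep continuous_su2Rep β).measurable

/-! ## §3 Row and column sums of `E_β` -/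

variable (L) in
/-- `c_β^{|E|}` (`|E| = 3L³`), the row sum of the electric factor on the `L³` torus. [folklore] -/
def latCE (β : ℝ) : ℝ := linkC β ^ Fintype.card (Edge 3 L)

/-- `0 < c_β^{|E|}` (`β ≥ 0`). [folklore] -/
theorem latCE_pos {β : ℝ} (hβ : 0 ≤ β) : 0 < latCE L β := pow_pos (linkC_pos hβ) _

/-- `c_β^{|E|} ≤ e^{2β|E|}` (`β ≥ 0`). [folklore] -/
theorem latCE_le {β : ℝ} (hβ : 0 ≤ β) : latCE L β ≤ Real.exp (2 * β) ^ Fintype.card (Edge 3 L) :=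
  pow_le_pow_left₀ (linkC_pos hβ).le (linkC_le hβ) _

/-- Row sum: `∫ E_β(U,V) dμ(V) = c_β^{|E|}` (per-link inversion + left invariance of Haar, Fubini over the product measure). [folklore] -/
theorem integral_latE_snd (β : ℝ) (U : GaugeConfig 3 L SU2) : ∫ V, latE L β U V ∂configMeasure SU2 L = latCE L β := by
  unfold latE latCE
  rw [show (∫ V, ∏ e, linkW β (U e * (V e)⁻¹) ∂configMeasure SU2 L) =
      ∏ e : Edge 3 L, ∫ v, linkW β (U e * v⁻¹) ∂haarProbability SU2 from
    integral_fintype_prod_eq_prod (fun e v => linkW β (U e * v⁻¹))]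
  rw [Finset.prod_congr rfl fun e _ => integral_comp_mul_inv_left (linkW β) (U e), Finset.prod_const, Finset.card_univ]
  rfl

/-- Column sum: `∫ E_β(U,V) dμ(U) = c_β^{|E|}` (per-link right invariance of Haar). [folklore] -/
theorem integral_latE_fst (β : ℝ) (V : GaugeConfig 3 L SU2) : ∫ U, latE L β U V ∂configMeasure SU2 L = latCE L β := by
  unfold latE latCE
  rw [show (∫ U, ∏ e, linkW β (U e * (V e)⁻¹) ∂configMeasure SU2 L) =
      ∏ e : Edge 3 L, ∫ u, linkW β (u * (V e)⁻¹) ∂haarProbability SU2 from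
    integral_fintype_prod_eq_prod (fun e u => linkW β (u * (V e)⁻¹))]
  rw [Finset.prod_congr rfl fun e _ => integral_comp_mul_inv_right (linkW β) (V e), Finset.prod_const, Finset.card_univ]
  rfl

/-- A bounded measurable function on `GaugeConfig 3 L SU2 × GaugeConfig 3 L SU2` is integrable for the product a-priori measure. [folklore] -/
theorem integrable_latProd {F : GaugeConfig 3 L SU2 × GaugeConfig 3 L SU2 → ℝ} (hF : Measurable F) {C : ℝ} (hC : ∀ p, |F p| ≤ C) :
    Integrable F ((configMeasure SU2 L).prod (configMeasure SU2 L)) :=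
  integrable_of_measurable_abs_le _ hF hC

/-- Sandwich integrability `f(U) H(U,V) f'(V)` for bounded measurable data on the `L³` torus. [folklore] -/
theorem integrable_latSandwich {H : GaugeConfig 3 L SU2 × GaugeConfig 3 L SU2 → ℝ} (hH : Measurable H) {R : ℝ} (hR : ∀ p, |H p| ≤ R)
    {f f' : GaugeConfig 3 L SU2 → ℝ} (hf : Measurable f) (hf' : Measurable f') {C C' : ℝ} (hfb : ∀ U, |f U| ≤ C) (hf'b : ∀ V, |f' V| ≤ C') :
    Integrable (fun p : GaugeConfig 3 L SU2 × GaugeConfig 3 L SU2 => f p.1 * H p * f' p.2)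
      ((configMeasure SU2 L).prod (configMeasure SU2 L)) := by
  refine integrable_latProd (((hf.comp measurable_fst).mul hH).mul (hf'.comp measurable_snd)) (C := C * R * C') fun p => ?_
  rw [abs_mul, abs_mul]
  have hC : 0 ≤ C := (abs_nonneg _).trans (hfb p.1)
  exact mul_le_mul (mul_le_mul (hfb _) (hR _) (abs_nonneg _) hC) (hf'b _) (abs_nonneg _)
    (mul_nonneg hC ((abs_nonneg _).trans (hR p)))

/-- **Row identity** `∫∫ E_β(U,V) Φ(U) d(μ⊗μ) = c_β^{|E|} ∫ Φ dμ`. [folklore] -/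
theorem integral_prod_latE_mul_fst (β : ℝ) {Φ : GaugeConfig 3 L SU2 → ℝ} (hΦ : Measurable Φ) {C : ℝ} (hΦb : ∀ U, |Φ U| ≤ C) (hβ : 0 ≤ β) :
    ∫ p, latE L β p.1 p.2 * Φ p.1 ∂(configMeasure SU2 L).prod (configMeasure SU2 L) =
      latCE L β * ∫ U, Φ U ∂configMeasure SU2 L := by
  have hint : Integrable (fun p : GaugeConfig 3 L SU2 × GaugeConfig 3 L SU2 => latE L β p.1 p.2 * Φ p.1)
      ((configMeasure SU2 L).prod (configMeasure SU2 L)) := by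
    refine integrable_latProd ((measurable_latE β).mul (hΦ.comp measurable_fst))
      (C := Real.exp (2 * β) ^ Fintype.card (Edge 3 L) * C) fun p => ?_
    rw [abs_mul]; exact mul_le_mul (abs_latE_le hβ _ _) (hΦb _) (abs_nonneg _) (by positivity)
  rw [integral_prod _ hint]
  have inner : ∀ U : GaugeConfig 3 L SU2, ∫ V, latE L β U V * Φ U ∂configMeasure SU2 L = latCE L β * Φ U := fun U => by
    rw [integral_mul_const, integral_latE_snd]
  simp only [inner]
  rw [integral_const_mul]

/-- **Column identity** `∫∫ E_β(U,V) Φ(V) d(μ⊗μ) = c_β^{|E|} ∫ Φ dμ`. [folklore] -/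
theorem integral_prod_latE_mul_snd (β : ℝ) {Φ : GaugeConfig 3 L SU2 → ℝ} (hΦ : Measurable Φ) {C : ℝ} (hΦb : ∀ U, |Φ U| ≤ C) (hβ : 0 ≤ β) :
    ∫ p, latE L β p.1 p.2 * Φ p.2 ∂(configMeasure SU2 L).prod (configMeasure SU2 L) =
      latCE L β * ∫ V, Φ V ∂configMeasure SU2 L := by
  have hint : Integrable (fun p : GaugeConfig 3 L SU2 × GaugeConfig 3 L SU2 => latE L β p.1 p.2 * Φ p.2)
      ((configMeasure SU2 L).prod (configMeasure SU2 L)) := by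
    refine integrable_latProd ((measurable_latE β).mul (hΦ.comp measurable_snd))
      (C := Real.exp (2 * β) ^ Fintype.card (Edge 3 L) * C) fun p => ?_
    rw [abs_mul]; exact mul_le_mul (abs_latE_le hβ _ _) (hΦb _) (abs_nonneg _) (by positivity)
  rw [integral_prod_symm _ hint]
  have inner : ∀ V : GaugeConfig 3 L SU2, ∫ U, latE L β U V * Φ V ∂configMeasure SU2 L = latCE L β * Φ V := fun V => by
    rw [integral_mul_const, integral_latE_fst]
  simp only [inner]
  rw [integral_const_mul]

/-- `⟨ψ, K_β ψ⟩` as a product integral, for a physical `ψ` on the `L³` torus (`β ≥ 0`). [folklore] -/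
theorem qform_eq_integral_latProd {β : ℝ} (hβ : 0 ≤ β) {ψ : GaugeConfig 3 L SU2 → ℝ} (hψ : IsPhys ψ) :
    qform su2Rep β ψ ψ = ∫ p, ψ p.1 * transferKernel su2Rep β p.1 p.2 * ψ p.2
      ∂(configMeasure SU2 L).prod (configMeasure SU2 L) := by
  obtain ⟨C, hC⟩ := hψ.bounded
  exact (integral_prod _ (integrable_latSandwich (measurable_transferKernel_lat β) (abs_transferKernel_le_lat hβ)
    hψ.measurable hψ.measurable hC hC)).symm

end Summit.QuantumFields.YangMills.Theorems.FemtoTransferGap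

end
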